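import Literature.MathematicalPhysics.QuantumLattice.Phi4NewmanGaussianInequality
import HarnessLib

/-!
# Gaussian bounds for the free-boundary lattice `φ⁴` measures on `ℤᵈ` and their smeared fields

Proofs-only file (topic `Literature/MathematicalPhysics/QuantumLattice`; theorems only, no definition,
no named fact). Third step of the `φ⁴` line of Aizenman–Duminil-Copin 2021 in the tree's vocabulary,
after `GriffithsSimonApproximation.lean` (block-Ising approximation of `phi4Measure` on a finite
graph) and `Phi4NewmanGaussianInequality.lean` (the Gaussian inequality, ADC (6.3) lower half, and
Newman's exponential-moment domination for `phi4Measure`): the transport of those finite-graph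
statements to the objects the tree's `Literature.MathematicalPhysics.QuantumFieldTheory.phi44_triviality`
is stated with — the free-boundary volume measures `phi4FreeMeasure d Λ g κ J` /
`phi4BoxMeasure d R g κ J` on `ℤᵈ` (`LatticeScalarField.lean`: the graph measure on `↥Λ` glued with
`0` outside `Λ`), their correlation functions `phi4TwoPointIn` / `phi4TwoPointBox`, and the laws
`latticeFieldLaw (phi4BoxMeasure d R g κ J) (box d R) δ ρ` of the smeared field
`ω(f) = ρ δᵈ ∑_{x ∈ box} f(δx) φₓ` (whose thermodynamic limits `ν_δ` are the approximants of
`phi44_triviality` as restated).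

## Contents (all proved)

* Change of variables: `integral_phi4FreeMeasure` (`∫ H d(phi4FreeMeasure) = ∫ H ∘ glueZero d(phi4Measure (zdGraphIn d Λ))`),
  `integral_latticeFieldLaw`, `finLatticeField_glueZero_apply` and
  **`integral_comp_eval_latticeFieldLaw_phi4FreeMeasure`**: `∫ F(ω(f)) d(latticeFieldLaw (phi4FreeMeasure d Λ g κ J) Λ δ ρ)`
  is `∫ F(∑_{x : Λ} aₓ ψₓ) d(phi4Measure (zdGraphIn d Λ) g κ J)` with `aₓ = ρ δᵈ f(δx)`.
* Integrability: `integrable_phi4Measure_of_abs_le` (continuous observables with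
  `|F| ≤ C e^{b∑φ²}` are `phi4Measure`-integrable, `g > 0`),
  `integrable_comp_eval_latticeFieldLaw_phi4FreeMeasure` and its instances
  `integrable_exp_mul_eval_…`, `integrable_pow_eval_…` (all exponential moments and moments of the
  smeared field are finite).
* Variance: `integral_sq_eval_latticeFieldLaw_phi4FreeMeasure` (`∫ ω(f)² = ∑_{x,y∈Λ} aₓa_y ⟨φₓφ_y⟩_Λ`)
  and `integral_sq_eval_latticeFieldLaw_phi4FreeMeasure_le` (a two-point bound gives a variance bound).
* Smeared field, `f ≥ 0` at the lattice points of the volume, `ρ ≥ 0`, `δ ≥ 0`, `g > 0`, `J ≥ 0`: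
  **`latticeFieldLaw_phi4Free_integral_pow_le`** (`⟨ω(f)^{2m}⟩ ≤ (2m)!/(2^m m!) ⟨ω(f)²⟩^m`),
  **`latticeFieldLaw_phi4Free_integral_exp_mul_le`** (`⟨e^{tω(f)}⟩ ≤ exp(t²⟨ω(f)²⟩/2)`), and the
  box specialisations `latticeFieldLaw_phi4Box_integral_pow_le`,
  `latticeFieldLaw_phi4Box_integral_exp_mul_le` — the a-priori bounds by which a variance bound
  uniform in the volume `R` gives exponential moments bounded uniformly in `R` (the input for
  exponential integrability of `ω(f)` under the thermodynamic limits `ν_δ`).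
* Correlation functions: **`phi4Free_integral_prod_le_pairingSum`**, `phi4Free_nPoint_le_pairingSum`,
  `phi4Box_nPoint_le_pairingSum`: for `x₁,…,x_{2m} ∈ Λ`,
  `⟨φ_{x₁}⋯φ_{x_{2m}}⟩_Λ ≤ 𝒢_m[⟨φφ⟩_Λ](x)` (`pairingSum (phi4TwoPointIn d Λ g κ J) m x`), the lower
  half of ADC (6.3) for the free-boundary lattice `φ⁴` states (`m = 2`: Lebowitz' `U₄ ≤ 0`).

## What is NOT here

Thermodynamic limits (`R → ∞`), the variance bounds themselves (infrared bound / regularity, ADC §5),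
signed test functions, and anything about the torus measures.

## Sources

* M. Aizenman, H. Duminil-Copin, Ann. Math. 194 (2021), arXiv:1912.07973, §1.2 (p. 4: the lattice
  `φ⁴` measures and `T_{f,L}`), §6.3 (6.3) (p. 26), §7 (p. 28). [AizenmanDuminilCopinAnnals2021]
* C. M. Newman, Comm. Math. Phys. 41 (1975) 1–9, Thm 5 (as vendored in
  `GaussianPairingBoundCouplings.lean`). [Newman1975]

## Tree anchors

`phi4_integral_pow_le`, `phi4_integral_exp_mul_le`, `phi4_integral_prod_le_pairingSum`
(`Phi4NewmanGaussianInequality`); `phi4FreeMeasure`, `phi4BoxMeasure`, `latticeFieldLaw`,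
`finLatticeField_apply`, `measurable_finLatticeField`, `glueZero`, `measurable_glueZero`
(`LatticeScalarField`); `phi4TwoPointIn_eq_of_mem`, `isEvenSitePotential_phi4`,
`IsEvenSitePotential.integrable_exp_mul_sum_sq`, `abs_pow_le_exp_mul_sq` (`LatticeScalarFieldGriffithsProofs`);
`integrable_exp_neg_phi4Action`, `abs_pairInteraction_le` (`LatticeScalarFieldProofs`); Mathlib `integrable_tilted_iff`;
`measurable_eval` (`RandomField`); `pairingSum_congr_of_eq` (`GaussianPairingBound`); `nPoint`
(`Correlations`).
-/

noncomputable section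

open MeasureTheory Filter Topology Finset
open scoped SchwartzMap

namespace Literature.MathematicalPhysics.QuantumLattice

open Literature.Probability.LatticeModels

variable (d : ℕ)

/-! ### Change of variables: free-boundary volumes and smeared fields -/

section ChangeOfVariables

/-- Expectations under the free-boundary `φ⁴` measure in the volume `Λ ⊂ ℤᵈ` are expectations
under the graph measure on `↥Λ` of the observable of the glued configuration (`Measure.map` along
`glueZero Λ`). [folklore] -/
theorem integral_phi4FreeMeasure (Λ : Finset (Site d)) (g κ J : ℝ) {H : (Site d → ℝ) → ℝ}
    (hH : Measurable H) :
    ∫ φ, H φ ∂(phi4FreeMeasure d Λ g κ J) =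
      ∫ ψ, H (glueZero Λ ψ) ∂(phi4Measure (zdGraphIn d Λ) g κ J) := by
  unfold phi4FreeMeasure
  rw [integral_map (measurable_glueZero Λ).aemeasurable hH.aestronglyMeasurable]

/-- Expectations under the law of the smeared field are expectations of the smeared field
(`Measure.map` along `finLatticeField Λ δ ρ`). [folklore] -/
theorem integral_latticeFieldLaw (μ : Measure (Site d → ℝ)) (Λ : Finset (Site d)) (δ ρ : ℝ)
    {Ψ : FieldConfig (EuclideanSpace ℝ (Fin d)) → ℝ} (hΨ : Measurable Ψ) :
    ∫ ω, Ψ ω ∂(latticeFieldLaw μ Λ δ ρ) = ∫ φ, Ψ (finLatticeField Λ δ ρ φ) ∂μ := by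
  unfold latticeFieldLaw
  rw [integral_map (measurable_finLatticeField Λ δ ρ).aemeasurable hΨ.aestronglyMeasurable]

/-- The smeared field of a configuration glued with `0` outside `Λ` is the smeared field on the
graph `↥Λ`: `Φ_δ(f) = ∑_{x : Λ} (ρ δᵈ f(δx)) ψₓ`. [folklore] -/
theorem finLatticeField_glueZero_apply (Λ : Finset (Site d)) (δ ρ : ℝ) (ψ : Λ → ℝ)
    (f : 𝓢(EuclideanSpace ℝ (Fin d), ℝ)) :
    finLatticeField Λ δ ρ (glueZero Λ ψ) f =
      ∑ x : Λ, (ρ * δ ^ d * f (δ • siteToE (x : Site d))) * ψ x := by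
  rw [finLatticeField_apply, ← Finset.sum_coe_sort]
  refine Finset.sum_congr rfl fun x _ => ?_
  have hx : glueZero Λ ψ (x : Site d) = ψ x := by
    simp only [glueZero, glueWith_apply_mem _ _ _ x.2, Subtype.coe_eta]
  rw [hx]
  ring

/-- **The smeared free-boundary `φ⁴` field is a smeared field on the finite graph `↥Λ`.** For a
measurable `F : ℝ → ℝ`,
`∫ F(ω(f)) d(latticeFieldLaw (phi4FreeMeasure d Λ g κ J) Λ δ ρ) = ∫ F(∑_{x : Λ} aₓ ψₓ) d(phi4Measure (zdGraphIn d Λ) g κ J)`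
with the weights `aₓ = ρ δᵈ f(δx)` — so that the finite-graph inequalities of
`Phi4NewmanGaussianInequality` apply to the approximants of the tree's `phi44_triviality`.
[folklore] -/
theorem integral_comp_eval_latticeFieldLaw_phi4FreeMeasure (Λ : Finset (Site d)) (g κ J δ ρ : ℝ)
    (f : 𝓢(EuclideanSpace ℝ (Fin d), ℝ)) {F : ℝ → ℝ} (hF : Measurable F) :
    ∫ ω, F (ω f) ∂(latticeFieldLaw (phi4FreeMeasure d Λ g κ J) Λ δ ρ) =
      ∫ ψ, F (∑ x : Λ, (ρ * δ ^ d * f (δ • siteToE (x : Site d))) * ψ x)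
        ∂(phi4Measure (zdGraphIn d Λ) g κ J) := by
  have h1 : Measurable fun ω : FieldConfig (EuclideanSpace ℝ (Fin d)) => F (ω f) :=
    hF.comp (measurable_eval f)
  have h2 : Measurable fun φ : Site d → ℝ => F (finLatticeField Λ δ ρ φ f) :=
    h1.comp (measurable_finLatticeField Λ δ ρ)
  unfold latticeFieldLaw phi4FreeMeasure
  rw [integral_map (measurable_finLatticeField Λ δ ρ).aemeasurable h1.aestronglyMeasurable,
    integral_map (measurable_glueZero Λ).aemeasurable h2.aestronglyMeasurable]
  refine integral_congr_ae (Eventually.of_forall fun ψ => ?_)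
  simp only [finLatticeField_glueZero_apply]

end ChangeOfVariables

/-! ### Integrability of Gaussian-exponential observables -/

section Integrability

variable {V : Type*} [Fintype V] (G : SimpleGraph V) [DecidableRel G.Adj]

/-- **Observables of Gaussian-exponential growth are integrable under the lattice `φ⁴` measure**
(`g > 0`): a continuous `F` with `|F(φ)| ≤ C e^{b ∑ₓ φₓ²}` is `phi4Measure G g κ J`-integrable —
`e^{-S} F` is dominated by `C e^{(b + |J| #E) ∑ φ²} ∏ₓ e^{-(gφₓ⁴+κφₓ²)}`, Lebesgue integrable by
`IsEvenSitePotential.integrable_exp_mul_sum_sq` (Glimm–Jaffe 1987, §4.1 (4.1.4), the integrability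
hypothesis, derived for `φ⁴`). [cite: GlimmJaffeQP1987, §4.1 (4.1.4)] -/
theorem integrable_phi4Measure_of_abs_le {g : ℝ} (hg : 0 < g) (κ J : ℝ) {F : (V → ℝ) → ℝ}
    (hF : Continuous F) {C b : ℝ} (hFb : ∀ φ, |F φ| ≤ C * Real.exp (b * ∑ x, φ x ^ 2)) :
    Integrable F (phi4Measure G g κ J) := by
  classical
  have hU := isEvenSitePotential_phi4 (V := V) hg κ
  rw [phi4Measure, integrable_tilted_iff (integrable_exp_neg_phi4Action G hg κ J)]
  have hdom := (hU.integrable_exp_mul_sum_sq (b + |J| * G.edgeFinset.card)).const_mul C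
  refine hdom.mono'
    (((measurable_phi4Action G g κ J).neg.exp.aestronglyMeasurable).smul hF.aestronglyMeasurable)
    (Eventually.of_forall fun φ => ?_)
  rw [norm_smul, Real.norm_eq_abs, Real.norm_eq_abs, abs_of_pos (Real.exp_pos _)]
  have hJP : J * pairInteraction G φ ≤ |J| * G.edgeFinset.card * ∑ x, φ x ^ 2 :=
    calc J * pairInteraction G φ ≤ |J * pairInteraction G φ| := le_abs_self _
      _ = |J| * |pairInteraction G φ| := abs_mul _ _
      _ ≤ |J| * (G.edgeFinset.card * ∑ x, φ x ^ 2) :=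
          mul_le_mul_of_nonneg_left (abs_pairInteraction_le G φ) (abs_nonneg _)
      _ = |J| * G.edgeFinset.card * ∑ x, φ x ^ 2 := by ring
  have hS : -phi4Action G g κ J φ ≤
      |J| * G.edgeFinset.card * (∑ x, φ x ^ 2) - ∑ x, phi4Potential g κ x (φ x) := by
    simp only [phi4Action, phi4Potential]
    linarith
  have hC : 0 ≤ C * Real.exp (b * ∑ x, φ x ^ 2) := (abs_nonneg _).trans (hFb φ)
  calc Real.exp (-phi4Action G g κ J φ) * |F φ|
      ≤ Real.exp (|J| * G.edgeFinset.card * (∑ x, φ x ^ 2) - ∑ x, phi4Potential g κ x (φ x)) *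
          (C * Real.exp (b * ∑ x, φ x ^ 2)) :=
        mul_le_mul (Real.exp_le_exp.2 hS) (hFb φ) (abs_nonneg _) (Real.exp_pos _).le
    _ = C * (Real.exp ((b + |J| * G.edgeFinset.card) * ∑ x, φ x ^ 2) *
          Real.exp (-∑ x, phi4Potential g κ x (φ x))) := by
        rw [Real.exp_sub, add_mul, Real.exp_add, Real.exp_neg, div_eq_mul_inv]
        ring

end Integrability

section IntegrabilitySmeared

/-- Continuous observables of the smeared field with `|F(u)| ≤ C e^{b u²}` (`b ≥ 0`) are integrable
under the law of the smeared free-boundary `φ⁴` field (`integrable_phi4Measure_of_abs_le` after the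
change of variables, `(∑ aₓψₓ)² ≤ (∑ aₓ²)(∑ ψₓ²)`). [folklore] -/
theorem integrable_comp_eval_latticeFieldLaw_phi4FreeMeasure (Λ : Finset (Site d)) {g : ℝ}
    (hg : 0 < g) (κ J δ ρ : ℝ) (f : 𝓢(EuclideanSpace ℝ (Fin d), ℝ)) {F : ℝ → ℝ} (hF : Continuous F)
    {C b : ℝ} (hb : 0 ≤ b) (hFb : ∀ u, |F u| ≤ C * Real.exp (b * u ^ 2)) :
    Integrable (fun ω : FieldConfig (EuclideanSpace ℝ (Fin d)) => F (ω f))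
      (latticeFieldLaw (phi4FreeMeasure d Λ g κ J) Λ δ ρ) := by
  have h1 : Measurable fun ω : FieldConfig (EuclideanSpace ℝ (Fin d)) => F (ω f) :=
    hF.measurable.comp (measurable_eval f)
  have h2 : Measurable fun φ : Site d → ℝ => F (finLatticeField Λ δ ρ φ f) :=
    h1.comp (measurable_finLatticeField Λ δ ρ)
  unfold latticeFieldLaw phi4FreeMeasure
  rw [integrable_map_measure h1.aestronglyMeasurable (measurable_finLatticeField Λ δ ρ).aemeasurable]
  change Integrable (fun φ : Site d → ℝ => F (finLatticeField Λ δ ρ φ f)) _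
  rw [integrable_map_measure h2.aestronglyMeasurable (measurable_glueZero Λ).aemeasurable]
  have heq : ((fun φ : Site d → ℝ => F (finLatticeField Λ δ ρ φ f)) ∘ glueZero Λ) =
      fun ψ => F (∑ x : Λ, (ρ * δ ^ d * f (δ • siteToE (x : Site d))) * ψ x) := by
    funext ψ
    simp only [Function.comp_apply, finLatticeField_glueZero_apply]
  rw [heq]
  set a : Λ → ℝ := fun x => ρ * δ ^ d * f (δ • siteToE (x : Site d)) with ha
  have hC : 0 ≤ C := by
    have h := (abs_nonneg _).trans (hFb 0)
    simpa using h
  refine integrable_phi4Measure_of_abs_le (zdGraphIn d Λ) hg κ J (by fun_prop) (C := C)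
    (b := b * ∑ x, a x ^ 2) fun ψ => (hFb _).trans ?_
  have hcs : (∑ x, a x * ψ x) ^ 2 ≤ (∑ x, a x ^ 2) * ∑ x, ψ x ^ 2 :=
    Finset.sum_mul_sq_le_sq_mul_sq _ _ _
  refine mul_le_mul_of_nonneg_left (Real.exp_le_exp.2 ?_) hC
  rw [mul_assoc]
  exact mul_le_mul_of_nonneg_left hcs hb

/-- All exponential moments of the smeared free-boundary `φ⁴` field are finite. [folklore] -/
theorem integrable_exp_mul_eval_latticeFieldLaw_phi4FreeMeasure (Λ : Finset (Site d)) {g : ℝ}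
    (hg : 0 < g) (κ J δ ρ : ℝ) (f : 𝓢(EuclideanSpace ℝ (Fin d), ℝ)) (t : ℝ) :
    Integrable (fun ω : FieldConfig (EuclideanSpace ℝ (Fin d)) => Real.exp (t * ω f))
      (latticeFieldLaw (phi4FreeMeasure d Λ g κ J) Λ δ ρ) :=
  integrable_comp_eval_latticeFieldLaw_phi4FreeMeasure d Λ hg κ J δ ρ f
    (F := fun u => Real.exp (t * u)) (by fun_prop)
    (C := Real.exp (t ^ 2 / 2)) (b := 1 / 2) (by norm_num) fun u => by
      rw [abs_of_pos (Real.exp_pos _), ← Real.exp_add, Real.exp_le_exp]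
      nlinarith [sq_nonneg (t - u)]

/-- All moments of the smeared free-boundary `φ⁴` field are finite. [folklore] -/
theorem integrable_pow_eval_latticeFieldLaw_phi4FreeMeasure (Λ : Finset (Site d)) {g : ℝ}
    (hg : 0 < g) (κ J δ ρ : ℝ) (f : 𝓢(EuclideanSpace ℝ (Fin d), ℝ)) (n : ℕ) :
    Integrable (fun ω : FieldConfig (EuclideanSpace ℝ (Fin d)) => (ω f) ^ n)
      (latticeFieldLaw (phi4FreeMeasure d Λ g κ J) Λ δ ρ) :=
  integrable_comp_eval_latticeFieldLaw_phi4FreeMeasure d Λ hg κ J δ ρ f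
    (F := fun u => u ^ n) (by fun_prop)
    (C := 1) (b := n) (Nat.cast_nonneg n) fun u => by
      rw [abs_pow, one_mul]
      exact abs_pow_le_exp_mul_sq u n

end IntegrabilitySmeared

/-! ### The variance of the smeared field in terms of the two-point function -/

section Variance

/-- **The variance of the smeared free-boundary `φ⁴` field is the two-point function smeared twice**:
`∫ ω(f)² d(latticeFieldLaw (phi4FreeMeasure d Λ g κ J) Λ δ ρ) = ∑_{x,y ∈ Λ} aₓ a_y ⟨φₓφ_y⟩_Λ`,
`aₓ = ρ δᵈ f(δx)` (Aizenman–Duminil-Copin 2021, §1.2: `⟨T_{f,L}²⟩` as a double sum of `S₂`).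
[cite: AizenmanDuminilCopinAnnals2021, §1.2 (p. 4)] -/
theorem integral_sq_eval_latticeFieldLaw_phi4FreeMeasure (Λ : Finset (Site d)) {g : ℝ} (hg : 0 < g)
    (κ J δ ρ : ℝ) (f : 𝓢(EuclideanSpace ℝ (Fin d), ℝ)) :
    ∫ ω, (ω f) ^ 2 ∂(latticeFieldLaw (phi4FreeMeasure d Λ g κ J) Λ δ ρ) =
      ∑ x ∈ Λ, ∑ y ∈ Λ, (ρ * δ ^ d * f (δ • siteToE x)) * (ρ * δ ^ d * f (δ • siteToE y)) *
        phi4TwoPointIn d Λ g κ J x y := by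
  classical
  rw [integral_comp_eval_latticeFieldLaw_phi4FreeMeasure d Λ g κ J δ ρ f
    (by fun_prop : Measurable fun u : ℝ => u ^ 2)]
  have hexp : ∀ ψ : Λ → ℝ, (∑ x : Λ, ρ * δ ^ d * f (δ • siteToE (x : Site d)) * ψ x) ^ 2 =
      ∑ x : Λ, ∑ y : Λ, (ρ * δ ^ d * f (δ • siteToE (x : Site d))) *
        (ρ * δ ^ d * f (δ • siteToE (y : Site d))) * (ψ x * ψ y) := fun ψ => by
    rw [sq, Finset.sum_mul_sum]
    exact Finset.sum_congr rfl fun x _ => Finset.sum_congr rfl fun y _ => by ring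
  simp_rw [hexp]
  have hint : ∀ x y : Λ, Integrable (fun ψ : Λ → ℝ => (ρ * δ ^ d * f (δ • siteToE (x : Site d))) *
      (ρ * δ ^ d * f (δ • siteToE (y : Site d))) * (ψ x * ψ y))
      (phi4Measure (zdGraphIn d Λ) g κ J) := fun x y =>
    (integrable_phi4Measure_of_abs_le (zdGraphIn d Λ) hg κ J (by fun_prop) (C := 1) (b := 1)
      (fun ψ => by
        rw [abs_mul, one_mul, one_mul]
        have hx := Finset.single_le_sum (fun z _ => sq_nonneg (ψ z)) (Finset.mem_univ x)
        have hy := Finset.single_le_sum (fun z _ => sq_nonneg (ψ z)) (Finset.mem_univ y)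
        nlinarith [abs_nonneg (ψ x), abs_nonneg (ψ y), sq_abs (ψ x), sq_abs (ψ y),
          Real.add_one_le_exp (∑ z, ψ z ^ 2), sq_nonneg (|ψ x| - |ψ y|)])).const_mul _
  rw [integral_finsetSum _ fun x _ => integrable_finsetSum _ fun y _ => hint x y]
  simp_rw [integral_finsetSum _ fun y _ => hint _ y, integral_const_mul]
  rw [← Finset.sum_coe_sort Λ]
  refine Finset.sum_congr rfl fun x _ => ?_
  rw [← Finset.sum_coe_sort Λ]
  refine Finset.sum_congr rfl fun y _ => ?_
  rw [phi4TwoPointIn_eq_of_mem d Λ g κ J x.2 y.2]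

/-- **A two-point bound gives a variance bound**: if `⟨φₓφ_y⟩_Λ ≤ T(x,y)` on `Λ × Λ` and the weights are
nonnegative (`f ≥ 0` at the lattice points of `Λ`, `ρ ≥ 0`, `δ ≥ 0`), then
`∫ ω(f)² d(law_Λ) ≤ ∑_{x,y ∈ Λ} aₓ a_y T(x,y)`; with a bound uniform in the volume this is the
hypothesis of the thermodynamic-limit statements of
`QuantumFieldTheory/ContinuumLimitsPhi4GaussianDomination`. [folklore] -/
theorem integral_sq_eval_latticeFieldLaw_phi4FreeMeasure_le (Λ : Finset (Site d)) {g : ℝ}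
    (hg : 0 < g) (κ J : ℝ) {δ ρ : ℝ} (hδ : 0 ≤ δ) (hρ : 0 ≤ ρ) {f : 𝓢(EuclideanSpace ℝ (Fin d), ℝ)}
    (hf : ∀ x ∈ Λ, 0 ≤ f (δ • siteToE x)) {T : Site d → Site d → ℝ}
    (hT : ∀ x ∈ Λ, ∀ y ∈ Λ, phi4TwoPointIn d Λ g κ J x y ≤ T x y) :
    ∫ ω, (ω f) ^ 2 ∂(latticeFieldLaw (phi4FreeMeasure d Λ g κ J) Λ δ ρ) ≤
      ∑ x ∈ Λ, ∑ y ∈ Λ, (ρ * δ ^ d * f (δ • siteToE x)) * (ρ * δ ^ d * f (δ • siteToE y)) *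
        T x y := by
  rw [integral_sq_eval_latticeFieldLaw_phi4FreeMeasure d Λ hg κ J δ ρ f]
  refine Finset.sum_le_sum fun x hx => Finset.sum_le_sum fun y hy => ?_
  have hax : 0 ≤ ρ * δ ^ d * f (δ • siteToE x) := mul_nonneg (mul_nonneg hρ (pow_nonneg hδ _)) (hf x hx)
  have hay : 0 ≤ ρ * δ ^ d * f (δ • siteToE y) := mul_nonneg (mul_nonneg hρ (pow_nonneg hδ _)) (hf y hy)
  exact mul_le_mul_of_nonneg_left (hT x hx y hy) (mul_nonneg hax hay)

end Variance

/-! ### Gaussian bounds for the smeared free-boundary `φ⁴` field -/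

section Smeared

/-- **Newman's Gaussian inequality for the smeared free-boundary `φ⁴` field on `ℤᵈ`.** For `g > 0`,
`J ≥ 0`, `ρ ≥ 0`, `δ ≥ 0` and a test function that is `≥ 0` at the lattice points of `Λ`, the smeared
field `ω(f)` under `latticeFieldLaw (phi4FreeMeasure d Λ g κ J) Λ δ ρ` has Gaussian-dominated even
moments `⟨ω(f)^{2m}⟩ ≤ (2m)!/(2^m m!) ⟨ω(f)²⟩^m` (`phi4_integral_pow_le` on the graph `↥Λ`).
[cite: Newman1975, Theorem 5, eq. (2.8); AizenmanDuminilCopinAnnals2021, §7 (p. 28)] -/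
theorem latticeFieldLaw_phi4Free_integral_pow_le (Λ : Finset (Site d)) {g : ℝ} (hg : 0 < g) (κ : ℝ)
    {J : ℝ} (hJ : 0 ≤ J) {δ ρ : ℝ} (hδ : 0 ≤ δ) (hρ : 0 ≤ ρ) {f : 𝓢(EuclideanSpace ℝ (Fin d), ℝ)}
    (hf : ∀ x ∈ Λ, 0 ≤ f (δ • siteToE x)) (m : ℕ) :
    ∫ ω, (ω f) ^ (2 * m) ∂(latticeFieldLaw (phi4FreeMeasure d Λ g κ J) Λ δ ρ) ≤
      ((2 * m).factorial : ℝ) / (2 ^ m * m.factorial) *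
        (∫ ω, (ω f) ^ 2 ∂(latticeFieldLaw (phi4FreeMeasure d Λ g κ J) Λ δ ρ)) ^ m := by
  rw [integral_comp_eval_latticeFieldLaw_phi4FreeMeasure d Λ g κ J δ ρ f
      (by fun_prop : Measurable fun u : ℝ => u ^ (2 * m)),
    integral_comp_eval_latticeFieldLaw_phi4FreeMeasure d Λ g κ J δ ρ f
      (by fun_prop : Measurable fun u : ℝ => u ^ 2)]
  exact phi4_integral_pow_le (zdGraphIn d Λ) hg κ hJ _
    (fun x => mul_nonneg (mul_nonneg hρ (pow_nonneg hδ _)) (hf x x.2)) m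

/-- **Gaussian domination of the exponential moments of the smeared free-boundary `φ⁴` field on
`ℤᵈ`**: under the same hypotheses, `⟨e^{t ω(f)}⟩ ≤ exp(t² ⟨ω(f)²⟩ / 2)` for all real `t`
(`phi4_integral_exp_mul_le` on the graph `↥Λ`). In particular all exponential moments of the smeared
field are controlled by its variance, uniformly in the volume once the variance is. [folklore] -/
theorem latticeFieldLaw_phi4Free_integral_exp_mul_le (Λ : Finset (Site d)) {g : ℝ} (hg : 0 < g)
    (κ : ℝ) {J : ℝ} (hJ : 0 ≤ J) {δ ρ : ℝ} (hδ : 0 ≤ δ) (hρ : 0 ≤ ρ)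
    {f : 𝓢(EuclideanSpace ℝ (Fin d), ℝ)} (hf : ∀ x ∈ Λ, 0 ≤ f (δ • siteToE x)) (t : ℝ) :
    ∫ ω, Real.exp (t * ω f) ∂(latticeFieldLaw (phi4FreeMeasure d Λ g κ J) Λ δ ρ) ≤
      Real.exp (t ^ 2 * (∫ ω, (ω f) ^ 2 ∂(latticeFieldLaw (phi4FreeMeasure d Λ g κ J) Λ δ ρ)) / 2) := by
  rw [integral_comp_eval_latticeFieldLaw_phi4FreeMeasure d Λ g κ J δ ρ f
      (by fun_prop : Measurable fun u : ℝ => Real.exp (t * u)),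
    integral_comp_eval_latticeFieldLaw_phi4FreeMeasure d Λ g κ J δ ρ f
      (by fun_prop : Measurable fun u : ℝ => u ^ 2)]
  exact phi4_integral_exp_mul_le (zdGraphIn d Λ) hg κ hJ _
    (fun x => mul_nonneg (mul_nonneg hρ (pow_nonneg hδ _)) (hf x x.2)) t

/-- The box specialisation, in the literal shape of the approximants of the tree's
`phi44_triviality` (`latticeFieldLaw (phi4BoxMeasure d R g κ J) (box d R) δ ρ`): Gaussian domination
of the exponential moments of `ω(f)` for `f ≥ 0` on the lattice points, `ρ ≥ 0`, `δ ≥ 0`, `J ≥ 0`.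
[folklore] -/
theorem latticeFieldLaw_phi4Box_integral_exp_mul_le (R : ℕ) {g : ℝ} (hg : 0 < g) (κ : ℝ) {J : ℝ}
    (hJ : 0 ≤ J) {δ ρ : ℝ} (hδ : 0 ≤ δ) (hρ : 0 ≤ ρ) {f : 𝓢(EuclideanSpace ℝ (Fin d), ℝ)}
    (hf : ∀ x ∈ box d R, 0 ≤ f (δ • siteToE x)) (t : ℝ) :
    ∫ ω, Real.exp (t * ω f) ∂(latticeFieldLaw (phi4BoxMeasure d R g κ J) (box d R) δ ρ) ≤
      Real.exp (t ^ 2 *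
        (∫ ω, (ω f) ^ 2 ∂(latticeFieldLaw (phi4BoxMeasure d R g κ J) (box d R) δ ρ)) / 2) :=
  latticeFieldLaw_phi4Free_integral_exp_mul_le d (box d R) hg κ hJ hδ hρ hf t

/-- The box specialisation of Newman's even-moment inequality for the smeared field. [folklore] -/
theorem latticeFieldLaw_phi4Box_integral_pow_le (R : ℕ) {g : ℝ} (hg : 0 < g) (κ : ℝ) {J : ℝ}
    (hJ : 0 ≤ J) {δ ρ : ℝ} (hδ : 0 ≤ δ) (hρ : 0 ≤ ρ) {f : 𝓢(EuclideanSpace ℝ (Fin d), ℝ)}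
    (hf : ∀ x ∈ box d R, 0 ≤ f (δ • siteToE x)) (m : ℕ) :
    ∫ ω, (ω f) ^ (2 * m) ∂(latticeFieldLaw (phi4BoxMeasure d R g κ J) (box d R) δ ρ) ≤
      ((2 * m).factorial : ℝ) / (2 ^ m * m.factorial) *
        (∫ ω, (ω f) ^ 2 ∂(latticeFieldLaw (phi4BoxMeasure d R g κ J) (box d R) δ ρ)) ^ m :=
  latticeFieldLaw_phi4Free_integral_pow_le d (box d R) hg κ hJ hδ hρ hf m

end Smeared

/-! ### The Gaussian inequality for the free-boundary correlation functions on `ℤᵈ` -/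

section Correlations

/-- **The Gaussian (Newman–Aizenman) inequality for the free-boundary `φ⁴` correlation functions
on `ℤᵈ`**: for `g > 0`, `J ≥ 0`, a finite volume `Λ` and points `x₁, …, x_{2m} ∈ Λ`,
`⟨φ_{x₁} ⋯ φ_{x_{2m}}⟩_Λ ≤ 𝒢_m[⟨φφ⟩_Λ](x)` with the finite-volume two-point function
`phi4TwoPointIn d Λ g κ J` — the lower half `S_{2n} ≤ 𝒢_n[S]` of Aizenman–Duminil-Copin 2021,
(6.3), for the free-boundary lattice `φ⁴` measures (`phi4_integral_prod_le_pairingSum` on the graph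
`↥Λ`, `phi4TwoPointIn_eq_of_mem`). [cite: AizenmanDuminilCopinAnnals2021, §6.3 (6.3), lower inequality (p. 26), with §7 (p. 28)] -/
theorem phi4Free_integral_prod_le_pairingSum (Λ : Finset (Site d)) {g : ℝ} (hg : 0 < g) (κ : ℝ)
    {J : ℝ} (hJ : 0 ≤ J) (m : ℕ) (x : Fin (2 * m) → Site d) (hx : ∀ i, x i ∈ Λ) :
    ∫ φ, ∏ i, φ (x i) ∂(phi4FreeMeasure d Λ g κ J) ≤ pairingSum (phi4TwoPointIn d Λ g κ J) m x := by
  classical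
  rw [integral_phi4FreeMeasure d Λ g κ J (by fun_prop)]
  have hglue : ∀ ψ : Λ → ℝ, ∏ i, glueZero Λ ψ (x i) = ∏ i, ψ ⟨x i, hx i⟩ := fun ψ =>
    Finset.prod_congr rfl fun i _ => glueWith_apply_mem _ _ _ (hx i)
  simp_rw [hglue]
  refine (phi4_integral_prod_le_pairingSum (zdGraphIn d Λ) hg κ hJ m fun i => ⟨x i, hx i⟩).trans_eq
    ?_
  exact pairingSum_congr_of_eq _ _ m _ _ fun i j =>
    (phi4TwoPointIn_eq_of_mem d Λ g κ J (hx i) (hx j)).symm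

/-- The same in the tree's correlation-function vocabulary: for `x₁, …, x_{2m} ∈ Λ`,
`nPoint (phi4FreeMeasure d Λ g κ J) (φ ↦ φₓ) x ≤ 𝒢_m[phi4TwoPointIn d Λ g κ J](x)`. [cite: AizenmanDuminilCopinAnnals2021, §6.3 (6.3), lower inequality (p. 26)] -/
theorem phi4Free_nPoint_le_pairingSum (Λ : Finset (Site d)) {g : ℝ} (hg : 0 < g) (κ : ℝ) {J : ℝ}
    (hJ : 0 ≤ J) (m : ℕ) (x : Fin (2 * m) → Site d) (hx : ∀ i, x i ∈ Λ) :
    nPoint (phi4FreeMeasure d Λ g κ J) (fun z (φ : Site d → ℝ) => φ z) x ≤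
      pairingSum (phi4TwoPointIn d Λ g κ J) m x :=
  phi4Free_integral_prod_le_pairingSum d Λ hg κ hJ m x hx

/-- Box specialisation: for `x₁, …, x_{2m} ∈ box d R`,
`nPoint (phi4BoxMeasure d R g κ J) (φ ↦ φₓ) x ≤ 𝒢_m[phi4TwoPointBox d R g κ J](x)`; for `m = 2`
this is Lebowitz' inequality `U₄ ≤ 0` for the free-boundary box states. [cite: AizenmanDuminilCopinAnnals2021, §6.3 (6.3), lower inequality (p. 26)] -/
theorem phi4Box_nPoint_le_pairingSum (R : ℕ) {g : ℝ} (hg : 0 < g) (κ : ℝ) {J : ℝ} (hJ : 0 ≤ J)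
    (m : ℕ) (x : Fin (2 * m) → Site d) (hx : ∀ i, x i ∈ box d R) :
    nPoint (phi4BoxMeasure d R g κ J) (fun z (φ : Site d → ℝ) => φ z) x ≤
      pairingSum (phi4TwoPointBox d R g κ J) m x :=
  phi4Free_nPoint_le_pairingSum d (box d R) hg κ hJ m x hx

end Correlations

end Literature.MathematicalPhysics.QuantumLattice

end
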